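/-
Copyright (c) 2026. All rights reserved.
Released under Apache 2.0 license as described in the file LICENSE.
Authors: HodgeCM publication cell (pub-hodgecm), model-construction sub-cell, construction prover `mc-weil-1`.
-/
import Literature.RepresentationTheory.HeisenbergGroup.SchrodingerWeylElement
import Literature.NumberTheory.Automorphic.TateLocalSchwartzBruhat

/-!
# The rank-one non-archimedean case: Tate's Fourier transform as the Weyl operator

Topic `RepresentationTheory/HeisenbergGroup`; namespace `Literature.RepresentationTheory.HeisenbergGroup`.

Specialisation of `SchrodingerWeylElement.lean` to `X = Y = R = F` a NON-ARCHIMEDEAN LOCAL FIELD, `β = ` multiplication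
(`LinearMap.mul F F`), `γ = id`, `δ = -id` (so that `β (γ y) (δ x) = y·(-x) = -(x·y)`), `μ` an additive Haar measure:
the Heisenberg group is `F × F × F` with `(x,y,t)(x',y',t') = (x+x', y+y', t+t'+x y')`, the Schrödinger model is
`(ρ(x,y,t) f)(u) = ψ(t + u y) f(u + x)` on `𝒮(F)`, and the Weyl operator IS the tree's Tate–Fourier transform
`fourierSB ψ μ` (`weylFun_eq_fourierSB`).

DISCHARGE of the two hypotheses of `weylEquivSB` / `weylPair_mem_mpPairs` in this case:
* (i) stability of `𝒮(F)` — the tree THEOREM `Literature.NumberTheory.Automorphic.fourierSB_mem_schwartzBruhat`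
  (kernel, `TateLocalSchwartzBruhat.lean`, Bushnell–Henniart §23.1 Prop.);
* (ii) the inversion formula with `c = 1` — EXACTLY the tree's cited record
  `Literature.NumberTheory.Automorphic.IsSelfDualMeasure ψ μ` ("`(f̂)̂(x) = f(-x)` for `f ∈ 𝒮(F)`", Tate 1950
  Thm 2.2.2), carried here as the explicit hypothesis `(hμ : IsSelfDualMeasure ψ μ)` — never asserted.
Also: a continuous non-trivial `ψ` is locally constant (`isLocallyConstant_of_isContinuousNontrivial`, MVW Chap. 2 I.2,
first paragraph — kernel, from the tree's conductor exponent).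

Result: `tateWeylPair_mem_mpPairs` — for `ψ` continuous non-trivial and `μ` self-dual, the pair
(Weyl element `(x,y) ↦ (y,-x)` with `f(x,y) = -xy`, Fourier transform `𝒮(F) ≃ₗ[ℂ] 𝒮(F)` with inverse `f ↦ f̂(-·)`) lies in
the metaplectic-type group `mpPairs (schrodingerSB (LinearMap.mul F F) ψ …)` of the smooth Schrödinger model: Weil's
relation `d₀'(γ) ρ(h) d₀'(γ)⁻¹ = ρ(d₀'(γ)·h)` (n° 13, p. 160) at a finite place, KERNEL modulo Tate's Thm 2.2.2.
-/

set_option autoImplicit false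

noncomputable section

namespace Literature.RepresentationTheory.HeisenbergGroup

open _root_.MeasureTheory _root_.Filter
open scoped Topology Pointwise
open Literature.NumberTheory.Automorphic

variable {F : Type*} [Field F] [ValuativeRel F] [TopologicalSpace F] [IsNonarchimedeanLocalField F]

/-- **a continuous non-trivial additive character of a non-archimedean local field is locally constant** (MVW Chap. 2
I.2, first paragraph: "Un tel caractère est localement constant"): it is trivial on a ball `𝔭^m`, which is a
neighbourhood of `0`. [cite: MoeglinVignerasWaldspurger1987, Chap. 2 I.2] -/
theorem isLocallyConstant_of_isContinuousNontrivial {ψ : AddChar F Circle} (hψ : ψ.IsContinuousNontrivial) :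
    IsLocallyConstant (⇑ψ : F → Circle) := by
  obtain ⟨m, hm⟩ := hψ.exists_hasConductorExp
  rw [IsLocallyConstant.iff_eventually_eq]
  intro x
  have hx : x +ᵥ primePowBall F m ∈ 𝓝 x :=
    ((isOpen_primePowBall m).vadd x).mem_nhds ⟨0, zero_mem_primePowBall m, by simp⟩
  filter_upwards [hx] with y hy
  obtain ⟨h, hh, rfl⟩ := hy
  show ψ (x + h) = ψ x
  rw [AddChar.map_add_eq_mul, hm.1 h hh, mul_one]

/-- multiplication is continuous in the first variable (the hypothesis `hβ` of the Schrödinger / Weyl files for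
`β = LinearMap.mul F F`). [folklore] -/
theorem continuous_mul_left_apply (w : F) : Continuous fun v : F => LinearMap.mul F F v w :=
  continuous_id.mul continuous_const

omit [ValuativeRel F] [TopologicalSpace F] [IsNonarchimedeanLocalField F] in
/-- the self-duality relation `β (γ y) (δ x) = -β x y` for `β` = multiplication, `γ = id`, `δ = -id`. [folklore] -/
theorem mul_refl_neg (x y : F) :
    LinearMap.mul F F (LinearEquiv.refl F F y) (LinearEquiv.neg F x) = -LinearMap.mul F F x y := by
  simp only [LinearEquiv.refl_apply, LinearEquiv.neg_apply, LinearMap.mul_apply', mul_neg, mul_comm]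

omit [ValuativeRel F] [TopologicalSpace F] [IsNonarchimedeanLocalField F] in
/-- the rank-one Weyl element `((x,y) ↦ (y,-x), f(x,y) = -xy) ∈ PseudoSymplectic (polar (mul F F))`.
[cite: Weil1964, n° 6, p. 151] -/
def tateWeylElt : Heisenberg.PseudoSymplectic (polar (LinearMap.mul F F)) :=
  weylElt (LinearMap.mul F F) (LinearEquiv.refl F F) (LinearEquiv.neg F) mul_refl_neg

omit [ValuativeRel F] [TopologicalSpace F] [IsNonarchimedeanLocalField F] in
/-- action of the rank-one Weyl element: `((x,y),t) ↦ ((y,-x), t - xy)`. [cite: Weil1964, n° 6, p. 151] -/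
theorem tateWeylElt_act (h : Heisenberg (polar (LinearMap.mul F F))) :
    (tateWeylElt (F := F)).act h = ⟨(h.v.2, -h.v.1), h.t - h.v.1 * h.v.2⟩ := by
  rw [tateWeylElt, weylElt_act]
  rfl

variable [MeasurableSpace F] [BorelSpace F] (ψ : AddChar F Circle) (μ : Measure F)

omit [ValuativeRel F] [TopologicalSpace F] [IsNonarchimedeanLocalField F] [BorelSpace F] in
/-- **in rank one the Weyl operator is Tate's Fourier transform**: `weylFun (mul) ψ μ id f = fourierSB ψ μ f`.
[cite: Weil1964, n° 13, p. 160] -/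
theorem weylFun_eq_fourierSB (f : F → ℂ) :
    weylFun (LinearMap.mul F F) ψ μ (LinearEquiv.refl F F) f = fourierSB ψ μ f := by
  funext u
  rw [weylFun_apply, fourierSB_apply]
  rfl

variable [μ.IsAddHaarMeasure]

/-- hypothesis (i) discharged: the Weyl operator preserves `𝒮(F)` (tree theorem `fourierSB_mem_schwartzBruhat`).
[cite: BushnellHenniart2006, §23.1, Proposition] -/
theorem weylFun_mem_schwartzBruhat {ψ : AddChar F Circle} (hψ : ψ.IsContinuousNontrivial) (f : SchwartzBruhat F) :
    weylFun (LinearMap.mul F F) ψ μ (LinearEquiv.refl F F) f ∈ SchwartzBruhat F := by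
  rw [weylFun_eq_fourierSB]
  exact fourierSB_mem_schwartzBruhat μ hψ f.2

omit [ValuativeRel F] [IsNonarchimedeanLocalField F] [BorelSpace F] [μ.IsAddHaarMeasure] in
/-- hypothesis (ii) in rank one IS the tree record `IsSelfDualMeasure ψ μ` (with `c = 1`). [cite: Tate1950, §2.2 Thm. 2.2.2] -/
theorem weylFun_weylFun_of_isSelfDualMeasure {ψ : AddChar F Circle} (hμ : IsSelfDualMeasure ψ μ)
    (f : SchwartzBruhat F) :
    weylFun (LinearMap.mul F F) ψ μ (LinearEquiv.refl F F) (weylFun (LinearMap.mul F F) ψ μ (LinearEquiv.refl F F) f)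
      = ((1 : ℂˣ) : ℂ) • fun u => (f : F → ℂ) (-u) := by
  rw [weylFun_eq_fourierSB, weylFun_eq_fourierSB, hμ f f.2, Units.val_one, one_smul]

/-- **Tate's Fourier transform as a linear automorphism of `𝒮(F)`** (inverse `f ↦ f̂(-·)`), for `ψ` continuous
non-trivial and `μ` self-dual. [cite: Tate1950, §2.2 Thm. 2.2.2] -/
def tateWeylEquivSB {ψ : AddChar F Circle} (hψ : ψ.IsContinuousNontrivial) (hμ : IsSelfDualMeasure ψ μ) :
    SchwartzBruhat F ≃ₗ[ℂ] SchwartzBruhat F :=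
  weylEquivSB (LinearMap.mul F F) ψ μ (LinearEquiv.refl F F) (isLocallyConstant_of_isContinuousNontrivial hψ)
    continuous_mul_left_apply (weylFun_mem_schwartzBruhat μ hψ) 1 (weylFun_weylFun_of_isSelfDualMeasure μ hμ)

/-- formula: `tateWeylEquivSB f = f̂`. [cite: Tate1950, §2.2 Thm. 2.2.2] -/
@[simp] theorem coe_tateWeylEquivSB {ψ : AddChar F Circle} (hψ : ψ.IsContinuousNontrivial)
    (hμ : IsSelfDualMeasure ψ μ) (f : SchwartzBruhat F) :
    ((tateWeylEquivSB μ hψ hμ f : SchwartzBruhat F) : F → ℂ) = fourierSB ψ μ f := by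
  rw [tateWeylEquivSB, coe_weylEquivSB, weylFun_eq_fourierSB]

/-- **Weil's relation for the Weyl element at a finite place, rank one**: the pair (Weyl element, Fourier transform on
`𝒮(F)`) lies in the metaplectic-type group of the smooth Schrödinger model — KERNEL modulo the cited Tate Thm 2.2.2
(`hμ`). [cite: Weil1964, n° 13, p. 160] -/
theorem tateWeylPair_mem_mpPairs {ψ : AddChar F Circle} (hψ : ψ.IsContinuousNontrivial)
    (hμ : IsSelfDualMeasure ψ μ) :
    (tateWeylElt, tateWeylEquivSB μ hψ hμ)
      ∈ mpPairs (schrodingerSB (LinearMap.mul F F) ψ (isLocallyConstant_of_isContinuousNontrivial hψ)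
          continuous_mul_left_apply) :=
  weylPair_mem_mpPairs (LinearMap.mul F F) ψ μ (LinearEquiv.refl F F) (LinearEquiv.neg F)
    (isLocallyConstant_of_isContinuousNontrivial hψ) continuous_mul_left_apply (weylFun_mem_schwartzBruhat μ hψ) 1
    (weylFun_weylFun_of_isSelfDualMeasure μ hμ) mul_refl_neg

end Literature.RepresentationTheory.HeisenbergGroup
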